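import Summits.CriticalPhenomena.PercolationContinuityZ3.Theorems.PercTorusSliceFillingNoCriticalTorusGiantNonSfGiantMarkov
import Summits.CriticalPhenomena.PercolationContinuityZ3.Theorems.PercTorusSliceFillingNoCriticalTorusGiantSfMassTransitive

/-!
# Crux `PercTorusSliceFilling.NoCriticalTorusGiant` (stmt-CriticalPhenomena-5407) — the transfer is exact

Helper file for the crux skeleton `Cruxes/NoCriticalTorusGiant/Lines/birth.lean`; lands with
`--supports stmt-CriticalPhenomena-5407`.

Write `T_n = (ℤ/nℤ)³` (`torusGraph 3 n`), `P = P_{T_n,p_c}` (`bondPercolation (torusGraph 3 n)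
(criticalProbI 3)`), `C(x) = openCluster ω x`, and `χ_n := E_{T_n,p_c} |C(0)|` (the critical torus
susceptibility).  We prove

* `noCriticalTorusGiant_iff_suscept_subextensive`:
  `NoCriticalTorusGiant ↔ χ_n / n³ → 0`, i.e. "no `ε n³`-giant at `p_c` on the 3-torus, for every
  `ε > 0`" is EQUIVALENT to subextensivity of the critical torus susceptibility;
* `sfMass_subextensive_of_noCriticalTorusGiant`: the crux implies the load-bearing stub S3 of the
  skeleton (`n⁻³ · E_{T_n,p_c}[|C(0)| · 1{C(0) slice-filling}] → 0`), so the skeleton's transfer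
  `S3 ⇒ crux` loses nothing.

## The arguments

* crux ⇒ susceptibility (`suscept_subextensive_of_noCriticalTorusGiant`).  Pointwise
  `|C(0)| ≤ ε n³ + n³ · 1{∃ x, ε n³ ≤ |C(x)|}` (`|C(0)| ≤ n³` always), so
  `χ_n / n³ ≤ ε + P(ε-giant)`, and the last term tends to `0`.
* susceptibility ⇒ crux (`noCriticalTorusGiant_of_suscept_subextensive`).  With `k = ⌈ε n³⌉ ≥ 1`,
  first moment over vertices (`S1b.natCast_mul_measureReal_le_sum`: the `≥ k` members `y` of a
  `k`-giant `C(x₀)` all have `C(y) = C(x₀)`) gives `k · P(∃ x, k ≤ |C(x)|) ≤ Σ_x P(k ≤ |C(x)|)`,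
  Markov gives `k · P(k ≤ |C(x)|) ≤ E|C(x)|`, and transitivity of the torus (translation by `x` is a
  graph automorphism, `torusGraph_adj_add_right`, preserving `P`, `bondPercolation_map_relabel_iso`)
  gives `E|C(x)| = χ_n`.  Hence `P(ε-giant) ≤ n³ χ_n / k² ≤ ε⁻² · χ_n / n³ → 0`.
* crux ⇒ S3: `0 ≤ |C(0)| · 1{sf_0} ≤ |C(0)|` pointwise; squeeze.
-/

noncomputable section

namespace Summit.CriticalPhenomena.PercolationContinuityZ3.Theorems.PercTorusSliceFillingNoCriticalTorusGiant

open MeasureTheory ProbabilityTheory Filter Topology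
open Literature.Probability.Percolation Literature.Probability.LatticeModels

namespace Transfer

/-- The discrete torus `T_n = (ℤ/nℤ)³` has `n³` vertices (`n ≠ 0`). [folklore] -/
theorem natCard_torusSite (n : ℕ) [NeZero n] : Nat.card (TorusSite 3 n) = n ^ 3 := by
  rw [Nat.card_eq_fintype_card]
  simp [ZMod.card, Finset.prod_const]

/-- Every open cluster of `T_n` has at most `n³` vertices (`n ≠ 0`). [folklore] -/
theorem ncard_openCluster_le (n : ℕ) [NeZero n] (ω : BondConfig (TorusSite 3 n))
    (x : TorusSite 3 n) : ((openCluster ω x).ncard : ℝ) ≤ (n : ℝ) ^ 3 := by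
  have h : (openCluster ω x).ncard ≤ n ^ 3 :=
    (Set.ncard_le_card _).trans (natCard_torusSite n).le
  exact_mod_cast h

/-- **Markov at a vertex.** On `T_n` (`n ≠ 0`), `k · P_{T_n,p}(k ≤ |C(x)|) ≤ E_{T_n,p} |C(x)|`
(integrate the pointwise bound `k · 1{k ≤ |C(x)|} ≤ |C(x)|` over the finite configuration space).
[folklore] -/
theorem natCast_mul_measureReal_le_integral_ncard (p : unitInterval) (n : ℕ) [NeZero n] (k : ℕ)
    (x : TorusSite 3 n) :
    (k : ℝ) * (bondPercolation (torusGraph 3 n) p).real {ω | k ≤ (openCluster ω x).ncard} ≤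
      ∫ ω, ((openCluster ω x).ncard : ℝ) ∂(bondPercolation (torusGraph 3 n) p) := by
  set A : Set (BondConfig (TorusSite 3 n)) := {ω | k ≤ (openCluster ω x).ncard} with hA
  -- the pointwise bound `k · 1_A ≤ |C(x)|`
  have hpt : ∀ ω, (k : ℝ) * A.indicator (1 : BondConfig (TorusSite 3 n) → ℝ) ω ≤
      ((openCluster ω x).ncard : ℝ) := by
    intro ω
    by_cases hω : ω ∈ A
    · rw [Set.indicator_of_mem hω, Pi.one_apply, mul_one]
      have hk : k ≤ (openCluster ω x).ncard := hω
      exact_mod_cast hk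
    · rw [Set.indicator_of_notMem hω, mul_zero]
      exact Nat.cast_nonneg _
  rw [← integral_indicator_one (MeasurableSet.of_discrete (s := A)), ← integral_const_mul]
  exact integral_mono Integrable.of_finite Integrable.of_finite hpt

/-- **Transitivity of the mean cluster size on the torus.** For every vertex `x` of `T_n` and every
`p`, `E_{T_n,p} |C(x)| = E_{T_n,p} |C(0)|`: the translation `y ↦ y + x` is a graph automorphism of
`torusGraph 3 n` (`torusGraph_adj_add_right`), so its relabelling preserves `P_{T_n,p}`
(`bondPercolation_map_relabel_iso`) and carries `C(0)` onto the cluster of `x`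
(`S2b.openCluster_relabel_of_eq`), preserving the cardinality. [folklore] -/
theorem integral_ncard_openCluster_eq_zero (p : unitInterval) (n : ℕ) (x : TorusSite 3 n) :
    ∫ ω, ((openCluster ω x).ncard : ℝ) ∂(bondPercolation (torusGraph 3 n) p) =
      ∫ ω, ((openCluster ω (0 : TorusSite 3 n)).ncard : ℝ) ∂(bondPercolation (torusGraph 3 n) p) := by
  -- the translation `y ↦ y + x` as a graph automorphism of the torus
  let φ : torusGraph 3 n ≃g torusGraph 3 n :=
    { toEquiv := Equiv.addRight x
      map_rel_iff' := fun {a b} => torusGraph_adj_add_right x a b }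
  -- its relabelling preserves the percolation measure
  have hmp : MeasurePreserving (BondConfig.relabel (sym2Equiv (Equiv.addRight x)))
      (bondPercolation (torusGraph 3 n) p) (bondPercolation (torusGraph 3 n) p) :=
    ⟨(BondConfig.relabel _).measurable, bondPercolation_map_relabel_iso φ p⟩
  refine (hmp.integral_comp' _).symm.trans (integral_congr_ae (Eventually.of_forall fun ω => ?_))
  have hC : openCluster (BondConfig.relabel (sym2Equiv (Equiv.addRight x)) ω) x =
      Equiv.addRight x '' openCluster ω 0 :=
    S2b.openCluster_relabel_of_eq (Equiv.addRight x) ω (zero_add x)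
  simp only [hC, Set.ncard_image_of_injective _ (Equiv.injective _)]

/-- **First moment over vertices for `k`-giants.** On `T_n` (`n ≠ 0`),
`k · P_{T_n,p}(∃ x, k ≤ |C(x)|) ≤ Σ_x P_{T_n,p}(k ≤ |C(x)|)`: on the event the `≥ k` members `y` of a
`k`-giant `C(x₀)` all have `C(y) = C(x₀)` (open reachability is an equivalence), so at least `k` of
the events `{k ≤ |C(y)|}` occur (`S1b.natCast_mul_measureReal_le_sum`). [folklore] -/
theorem natCast_mul_measureReal_exists_le_sum (p : unitInterval) (n k : ℕ) [NeZero n] :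
    (k : ℝ) * (bondPercolation (torusGraph 3 n) p).real
        {ω | ∃ x : TorusSite 3 n, k ≤ (openCluster ω x).ncard} ≤
      ∑ x : TorusSite 3 n, (bondPercolation (torusGraph 3 n) p).real
        {ω | k ≤ (openCluster ω x).ncard} := by
  refine S1b.natCast_mul_measureReal_le_sum (bondPercolation (torusGraph 3 n) p)
    (fun x => {ω | k ≤ (openCluster ω x).ncard}) _ k
    (fun _ => MeasurableSet.of_discrete) MeasurableSet.of_discrete ?_
  rintro ω ⟨x₀, hk₀⟩
  refine ⟨(openCluster ω x₀).toFinite.toFinset, ?_, fun y hy => ?_⟩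
  · rw [← Set.ncard_eq_toFinset_card _ (openCluster ω x₀).toFinite]
    exact hk₀
  · have hy' : y ∈ openCluster ω x₀ := (Set.Finite.mem_toFinset _).1 hy
    have hC : openCluster ω y = openCluster ω x₀ := by
      ext z
      simp only [openCluster, Set.mem_setOf_eq] at hy' ⊢
      exact ⟨fun h => hy'.trans h, fun h => hy'.symm.trans h⟩
    show k ≤ (openCluster ω y).ncard
    rw [hC]
    exact hk₀

/-- **The ε-giant probability is controlled by the susceptibility.** For `ε > 0` and `n ≠ 0`,
`P_{T_n,p_c}(∃ x, ε n³ ≤ |C(x)|) ≤ ε⁻² · (E_{T_n,p_c}|C(0)| / n³)`: with `k = ⌈ε n³⌉ ≥ 1` the event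
lies in `{∃ x, k ≤ |C(x)|}`, whose probability is at most `k⁻¹ Σ_x P(k ≤ |C(x)|)`
(`natCast_mul_measureReal_exists_le_sum`) `≤ k⁻² Σ_x E|C(x)|`
(`natCast_mul_measureReal_le_integral_ncard`) `= k⁻² n³ E|C(0)|`
(`integral_ncard_openCluster_eq_zero`) `≤ ε⁻² E|C(0)| / n³`. [folklore] -/
theorem measureReal_giant_le_suscept (ε : ℝ) (hε : 0 < ε) (n : ℕ) [NeZero n] :
    (bondPercolation (torusGraph 3 n) (criticalProbI 3)).real
        {ω | ∃ x : TorusSite 3 n, ε * (n : ℝ) ^ 3 ≤ ((openCluster ω x).ncard : ℝ)} ≤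
      ε⁻¹ ^ 2 * ((∫ ω, ((openCluster ω (0 : TorusSite 3 n)).ncard : ℝ)
        ∂(bondPercolation (torusGraph 3 n) (criticalProbI 3))) / (n : ℝ) ^ 3) := by
  set P := bondPercolation (torusGraph 3 n) (criticalProbI 3) with hP
  set M : ℝ := ∫ ω, ((openCluster ω (0 : TorusSite 3 n)).ncard : ℝ) ∂P with hM
  set k : ℕ := ⌈ε * (n : ℝ) ^ 3⌉₊ with hk
  have hn : 0 < n := Nat.pos_of_ne_zero (NeZero.ne n)
  have hn3 : (0 : ℝ) < (n : ℝ) ^ 3 := by positivity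
  have hεn : 0 < ε * (n : ℝ) ^ 3 := mul_pos hε hn3
  have hk1 : 1 ≤ k := Nat.ceil_pos.mpr hεn
  have hk0 : (0 : ℝ) < k := by exact_mod_cast hk1
  have hkge : ε * (n : ℝ) ^ 3 ≤ (k : ℝ) := Nat.le_ceil _
  have hM0 : 0 ≤ M := integral_nonneg fun ω => Nat.cast_nonneg _
  have hcard : (Finset.univ : Finset (TorusSite 3 n)).card = n ^ 3 := by
    rw [Finset.card_univ]; simp [ZMod.card, Finset.prod_const]
  -- the ε-giant event lies in the `k`-giant event
  have hsub : {ω : BondConfig (TorusSite 3 n) |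
        ∃ x : TorusSite 3 n, ε * (n : ℝ) ^ 3 ≤ ((openCluster ω x).ncard : ℝ)} ⊆
      {ω | ∃ x : TorusSite 3 n, k ≤ (openCluster ω x).ncard} := by
    rintro ω ⟨x, hx⟩
    exact ⟨x, Nat.ceil_le.mpr hx⟩
  -- Markov at each vertex, then transitivity
  have h3 : ∀ x : TorusSite 3 n, (k : ℝ) * P.real {ω | k ≤ (openCluster ω x).ncard} ≤ M := by
    intro x
    rw [hM, ← integral_ncard_openCluster_eq_zero (criticalProbI 3) n x]
    exact natCast_mul_measureReal_le_integral_ncard _ n k x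
  -- `k² · P(k-giant) ≤ n³ · E|C(0)|`
  have h4 : (k : ℝ) ^ 2 * P.real {ω | ∃ x : TorusSite 3 n, k ≤ (openCluster ω x).ncard} ≤
      (n : ℝ) ^ 3 * M := by
    calc (k : ℝ) ^ 2 * P.real {ω | ∃ x : TorusSite 3 n, k ≤ (openCluster ω x).ncard}
        = (k : ℝ) * ((k : ℝ) *
            P.real {ω | ∃ x : TorusSite 3 n, k ≤ (openCluster ω x).ncard}) := by ring
      _ ≤ (k : ℝ) * ∑ x : TorusSite 3 n, P.real {ω | k ≤ (openCluster ω x).ncard} :=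
          mul_le_mul_of_nonneg_left (natCast_mul_measureReal_exists_le_sum _ n k) hk0.le
      _ = ∑ x : TorusSite 3 n, (k : ℝ) * P.real {ω | k ≤ (openCluster ω x).ncard} := by
          rw [Finset.mul_sum]
      _ ≤ ∑ _x : TorusSite 3 n, M := Finset.sum_le_sum fun x _ => h3 x
      _ = (n : ℝ) ^ 3 * M := by
          rw [Finset.sum_const, hcard, nsmul_eq_mul]; push_cast; ring
  have h5 : P.real {ω | ∃ x : TorusSite 3 n, k ≤ (openCluster ω x).ncard} ≤
      ((k : ℝ) ^ 2)⁻¹ * ((n : ℝ) ^ 3 * M) := by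
    rw [le_inv_mul_iff₀ (pow_pos hk0 2)]
    exact h4
  -- coefficients: `n³/k² ≤ ε⁻²/n³`
  have hcoef : ((k : ℝ) ^ 2)⁻¹ * ((n : ℝ) ^ 3 * M) ≤ ε⁻¹ ^ 2 * (M / (n : ℝ) ^ 3) := by
    have h1 : ((k : ℝ) ^ 2)⁻¹ ≤ ((ε * (n : ℝ) ^ 3) ^ 2)⁻¹ :=
      inv_anti₀ (pow_pos hεn 2) (pow_le_pow_left₀ hεn.le hkge 2)
    calc ((k : ℝ) ^ 2)⁻¹ * ((n : ℝ) ^ 3 * M)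
        ≤ ((ε * (n : ℝ) ^ 3) ^ 2)⁻¹ * ((n : ℝ) ^ 3 * M) :=
          mul_le_mul_of_nonneg_right h1 (mul_nonneg hn3.le hM0)
      _ = ε⁻¹ ^ 2 * (M / (n : ℝ) ^ 3) := by
          field_simp
  exact (measureReal_mono hsub).trans (h5.trans hcoef)

/-- **The susceptibility is controlled by the ε-giant probability.** For `0 ≤ ε` and `n ≠ 0`,
`E_{T_n,p_c}|C(0)| ≤ ε n³ + n³ · P_{T_n,p_c}(∃ x, ε n³ ≤ |C(x)|)`: pointwise `|C(0)| ≤ n³`, and off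
the event `|C(0)| < ε n³`. [folklore] -/
theorem integral_ncard_le_giant (ε : ℝ) (hε : 0 ≤ ε) (n : ℕ) [NeZero n] :
    ∫ ω, ((openCluster ω (0 : TorusSite 3 n)).ncard : ℝ)
        ∂(bondPercolation (torusGraph 3 n) (criticalProbI 3)) ≤
      ε * (n : ℝ) ^ 3 + (n : ℝ) ^ 3 * (bondPercolation (torusGraph 3 n) (criticalProbI 3)).real
        {ω | ∃ x : TorusSite 3 n, ε * (n : ℝ) ^ 3 ≤ ((openCluster ω x).ncard : ℝ)} := by
  set P := bondPercolation (torusGraph 3 n) (criticalProbI 3) with hP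
  set E : Set (BondConfig (TorusSite 3 n)) :=
    {ω | ∃ x : TorusSite 3 n, ε * (n : ℝ) ^ 3 ≤ ((openCluster ω x).ncard : ℝ)} with hE
  have hn3 : (0 : ℝ) ≤ (n : ℝ) ^ 3 := by positivity
  -- the pointwise bound
  have hpt : ∀ ω, ((openCluster ω (0 : TorusSite 3 n)).ncard : ℝ) ≤
      ε * (n : ℝ) ^ 3 + (n : ℝ) ^ 3 * E.indicator (1 : BondConfig (TorusSite 3 n) → ℝ) ω := by
    intro ω
    by_cases hω : ω ∈ E
    · rw [Set.indicator_of_mem hω, Pi.one_apply, mul_one]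
      have h0 : 0 ≤ ε * (n : ℝ) ^ 3 := mul_nonneg hε hn3
      have h1 := ncard_openCluster_le n ω 0
      linarith
    · rw [Set.indicator_of_notMem hω, mul_zero, add_zero]
      have h1 : ¬ ε * (n : ℝ) ^ 3 ≤ ((openCluster ω (0 : TorusSite 3 n)).ncard : ℝ) :=
        fun h0 => hω ⟨0, h0⟩
      exact (not_le.1 h1).le
  calc ∫ ω, ((openCluster ω (0 : TorusSite 3 n)).ncard : ℝ) ∂P
      ≤ ∫ ω, (ε * (n : ℝ) ^ 3 +
          (n : ℝ) ^ 3 * E.indicator (1 : BondConfig (TorusSite 3 n) → ℝ) ω) ∂P :=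
        integral_mono Integrable.of_finite Integrable.of_finite hpt
    _ = ε * (n : ℝ) ^ 3 + (n : ℝ) ^ 3 * P.real E := by
        rw [integral_add Integrable.of_finite Integrable.of_finite, integral_const,
          integral_const_mul, integral_indicator_one MeasurableSet.of_discrete, probReal_univ,
          one_smul]

/-- Normalised form of `integral_ncard_le_giant`: for `0 ≤ ε` and `n ≠ 0`,
`E_{T_n,p_c}|C(0)| / n³ ≤ ε + P_{T_n,p_c}(∃ x, ε n³ ≤ |C(x)|)`. [folklore] -/
theorem suscept_div_le_giant (ε : ℝ) (hε : 0 ≤ ε) (n : ℕ) [NeZero n] :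
    (∫ ω, ((openCluster ω (0 : TorusSite 3 n)).ncard : ℝ)
        ∂(bondPercolation (torusGraph 3 n) (criticalProbI 3))) / (n : ℝ) ^ 3 ≤
      ε + (bondPercolation (torusGraph 3 n) (criticalProbI 3)).real
        {ω | ∃ x : TorusSite 3 n, ε * (n : ℝ) ^ 3 ≤ ((openCluster ω x).ncard : ℝ)} := by
  have hn : 0 < n := Nat.pos_of_ne_zero (NeZero.ne n)
  have hn3 : (0 : ℝ) < (n : ℝ) ^ 3 := by positivity
  rw [div_le_iff₀ hn3]
  calc _ ≤ _ := integral_ncard_le_giant ε hε n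
    _ = _ := by ring

/-- The normalised susceptibility `E_{T_n,p_c}|C(0)| / n³` is non-negative. [folklore] -/
theorem suscept_div_nonneg (n : ℕ) :
    0 ≤ (∫ ω, ((openCluster ω (0 : TorusSite 3 n)).ncard : ℝ)
        ∂(bondPercolation (torusGraph 3 n) (criticalProbI 3))) / (n : ℝ) ^ 3 :=
  div_nonneg (integral_nonneg fun _ => Nat.cast_nonneg _) (by positivity)

/-- Abstract squeeze: a non-negative real sequence eventually bounded by `c · I n` with `I → 0`
tends to `0`. [folklore] -/
theorem tendsto_zero_of_nonneg_of_eventually_le_mul {g I : ℕ → ℝ} (c : ℝ) (hg : ∀ n, 0 ≤ g n)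
    (hle : ∀ᶠ n in atTop, g n ≤ c * I n) (hI : Tendsto I atTop (𝓝 0)) :
    Tendsto g atTop (𝓝 0) := by
  have hup : Tendsto (fun n => c * I n) atTop (𝓝 0) := by
    simpa using hI.const_mul c
  exact tendsto_of_tendsto_of_tendsto_of_le_of_le' tendsto_const_nhds hup
    (Eventually.of_forall hg) hle

end Transfer

/-- **Susceptibility form ⇒ crux.** If the critical torus susceptibility is subextensive,
`E_{T_n,p_c}|C(0)| / n³ → 0`, then `NoCriticalTorusGiant` holds: for `ε > 0` and `n ≥ 1`,
`P_{T_n,p_c}(∃ x, ε n³ ≤ |C(x)|) ≤ ε⁻² · E_{T_n,p_c}|C(0)| / n³`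
(`Transfer.measureReal_giant_le_suscept`: first moment over vertices with `k = ⌈ε n³⌉`, Markov at
each vertex, transitivity of the torus). [folklore] -/
theorem noCriticalTorusGiant_of_suscept_subextensive
    (h : Tendsto (fun n : ℕ => (∫ ω, ((openCluster ω (0 : TorusSite 3 n)).ncard : ℝ)
        ∂(bondPercolation (torusGraph 3 n) (criticalProbI 3))) / (n : ℝ) ^ 3) atTop (nhds 0)) :
    Summit.CriticalPhenomena.PercolationContinuityZ3.Theses.PercTorusSliceFilling.NoCriticalTorusGiant := by
  intro ε hε
  refine Transfer.tendsto_zero_of_nonneg_of_eventually_le_mul (ε⁻¹ ^ 2)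
    (fun n => measureReal_nonneg) ?_ h
  filter_upwards [eventually_ge_atTop 1] with n hn
  haveI : NeZero n := ⟨by omega⟩
  exact Transfer.measureReal_giant_le_suscept ε hε n

/-- **Crux ⇒ susceptibility form.** `NoCriticalTorusGiant` implies that the critical torus
susceptibility is subextensive, `E_{T_n,p_c}|C(0)| / n³ → 0`: for every `ε > 0` and `n ≥ 1`,
`E|C(0)| / n³ ≤ ε + P_{T_n,p_c}(∃ x, ε n³ ≤ |C(x)|)` (`Transfer.suscept_div_le_giant`), and the last
term tends to `0`. [folklore] -/
theorem suscept_subextensive_of_noCriticalTorusGiant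
    (h : Summit.CriticalPhenomena.PercolationContinuityZ3.Theses.PercTorusSliceFilling.NoCriticalTorusGiant) :
    Tendsto (fun n : ℕ => (∫ ω, ((openCluster ω (0 : TorusSite 3 n)).ncard : ℝ)
        ∂(bondPercolation (torusGraph 3 n) (criticalProbI 3))) / (n : ℝ) ^ 3) atTop (nhds 0) := by
  refine tendsto_order.2 ⟨fun a ha => Eventually.of_forall fun n =>
    lt_of_lt_of_le ha (Transfer.suscept_div_nonneg n), fun b hb => ?_⟩
  have hb3 : 0 < b / 3 := by positivity
  have hev : ∀ᶠ n : ℕ in atTop, (bondPercolation (torusGraph 3 n) (criticalProbI 3)).real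
      {ω | ∃ x : TorusSite 3 n, b / 3 * (n : ℝ) ^ 3 ≤ ((openCluster ω x).ncard : ℝ)} < b / 3 :=
    (tendsto_order.1 (h (b / 3) hb3)).2 (b / 3) hb3
  filter_upwards [hev, eventually_ge_atTop 1] with n hn hn1
  haveI : NeZero n := ⟨by omega⟩
  calc (∫ ω, ((openCluster ω (0 : TorusSite 3 n)).ncard : ℝ)
        ∂(bondPercolation (torusGraph 3 n) (criticalProbI 3))) / (n : ℝ) ^ 3
      ≤ b / 3 + (bondPercolation (torusGraph 3 n) (criticalProbI 3)).real
          {ω | ∃ x : TorusSite 3 n, b / 3 * (n : ℝ) ^ 3 ≤ ((openCluster ω x).ncard : ℝ)} :=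
        Transfer.suscept_div_le_giant (b / 3) hb3.le n
    _ < b := by linarith

/-- **The transfer is exact.** `NoCriticalTorusGiant` (no `ε n³`-giant on the critical 3-torus, for
every `ε > 0`) is EQUIVALENT to subextensivity of the critical torus susceptibility,
`E_{T_n,p_c}|C(0)| / n³ → 0` (`suscept_subextensive_of_noCriticalTorusGiant`,
`noCriticalTorusGiant_of_suscept_subextensive`). [folklore] -/
theorem noCriticalTorusGiant_iff_suscept_subextensive :
    Summit.CriticalPhenomena.PercolationContinuityZ3.Theses.PercTorusSliceFilling.NoCriticalTorusGiant ↔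
    Tendsto (fun n : ℕ => (∫ ω, ((openCluster ω (0 : TorusSite 3 n)).ncard : ℝ)
        ∂(bondPercolation (torusGraph 3 n) (criticalProbI 3))) / (n : ℝ) ^ 3) atTop (nhds 0) :=
  ⟨suscept_subextensive_of_noCriticalTorusGiant, noCriticalTorusGiant_of_suscept_subextensive⟩

/-- **Crux ⇒ S3.** `NoCriticalTorusGiant` implies the load-bearing stub S3 of the skeleton: the
slice-filling susceptibility of the critical 3-torus is subextensive,
`n⁻³ · E_{T_n,p_c}[|C(0)| · 1{C(0) slice-filling}] → 0`.  Indeed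
`0 ≤ |C(0)| · 1{sf_0} ≤ |C(0)|` pointwise, and `E|C(0)| / n³ → 0` by
`suscept_subextensive_of_noCriticalTorusGiant`. [folklore] -/
theorem sfMass_subextensive_of_noCriticalTorusGiant
    (h : Summit.CriticalPhenomena.PercolationContinuityZ3.Theses.PercTorusSliceFilling.NoCriticalTorusGiant) :
    Tendsto (fun n : ℕ =>
      (∫ ω, {ω' | ∃ i : Fin 3, ∀ t : ZMod n,
            ∃ y ∈ openCluster ω' (0 : TorusSite 3 n), y i = t}.indicator
          (fun ω' => ((openCluster ω' (0 : TorusSite 3 n)).ncard : ℝ)) ω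
          ∂(bondPercolation (torusGraph 3 n) (criticalProbI 3))) / (n : ℝ) ^ 3)
      atTop (nhds 0) := by
  refine tendsto_of_tendsto_of_tendsto_of_le_of_le' tendsto_const_nhds
    (suscept_subextensive_of_noCriticalTorusGiant h) (Eventually.of_forall fun n => ?_) ?_
  · exact div_nonneg
      (integral_nonneg fun ω => Set.indicator_nonneg (fun _ _ => Nat.cast_nonneg _) ω)
      (by positivity)
  · filter_upwards [eventually_ge_atTop 1] with n hn
    haveI : NeZero n := ⟨by omega⟩
    refine div_le_div_of_nonneg_right ?_ (by positivity)
    exact integral_mono Integrable.of_finite Integrable.of_finite fun ω =>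
      Set.indicator_le_self' (fun _ _ => Nat.cast_nonneg _) ω

end Summit.CriticalPhenomena.PercolationContinuityZ3.Theorems.PercTorusSliceFillingNoCriticalTorusGiant

end
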